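import Summits.AtomisticToContinuum.BoseEinsteinCondensation.Theorems.BlockLatticeFSumBlockCondensation
import Summits.AtomisticToContinuum.BoseEinsteinCondensation.Theorems.BECIntegerBlockRotorFamilyToPeriodic
import Summits.AtomisticToContinuum.BoseEinsteinCondensation.Theorems.BECIntegerBlockRotorBlockModeCounting
import HarnessLib

/-!
# Route `BECIntegerBlockRotor` after 2026-08-31: the assembly chain with the PROVED items discharged
# (decomp-a2c · hand-1 g9)

With `BlockCondensation` (13595, `rotor_blockCondensation_proof`), `FamilyToPeriodic` (13598,
`familyToPeriodic_proof`) and `BlockModeCounting` (13597, `blockModeCounting_proof`) proved, the route's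
deciding chain `closes hMC hIR hBC hFC hFP hBT` collapses onto its three open cruxes plus the KLS pair:

* `familyBEC_of_blockInfraredBound : BlockInfraredBound → FamilyBEC` (target 13591 ⟸ crux 13593 alone);
* `periodicBEC_of_blockInfraredBound_of_fillingContinuity :
    BlockInfraredBound → FillingContinuity → (∀ v, PeriodicBEC v)` (the antecedent of `BoundaryTransferWeak`);
* `bec_of_three_cruxes : BlockInfraredBound → FillingContinuity → BoundaryTransferWeak → BoseEinsteinCondensation`;
* `bec_of_kls : KLSTransfer → BlockSusceptibilityBound → FillingContinuity → BoundaryTransferWeak →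
    BoseEinsteinCondensation` (the Gaussian-domination entrance 13592 through the support 13596).

Pure composition by name; no definitions, no `sorry`.
-/

noncomputable section

namespace Summit.AtomisticToContinuum.BoseEinsteinCondensation.Theorems.BECIntegerBlockRotorOutright

open Summit.AtomisticToContinuum.BoseEinsteinCondensation.Theses.BECIntegerBlockRotor

/-- **13591 ⟸ 13593**: the infrared bound for block plane waves alone gives BEC along the integer-filled
family (mode counting `blockModeCounting_proof` with the proved block floor `rotor_blockCondensation_proof`).
[folklore] -/
theorem familyBEC_of_blockInfraredBound (hIR : BlockInfraredBound) : FamilyBEC :=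
  BECIntegerBlockRotorBlockModeCounting.blockModeCounting_proof hIR
    BlockCondensation.rotor_blockCondensation_proof

/-- **Periodic BEC for every `v` ⟸ 13593 ∧ 13594**: the exact antecedent of `BoundaryTransferWeak`,
from the infrared bound and filling continuity (`familyToPeriodic_proof`). [folklore] -/
theorem periodicBEC_of_blockInfraredBound_of_fillingContinuity (hIR : BlockInfraredBound)
    (hFC : FillingContinuity) :
    ∀ v : ℝ → ENNReal, Literature.MathematicalPhysics.QuantumManyBody.BoseGas.IsRepulsiveFiniteRange v →
      ∃ ρ₀ : ℝ, 0 < ρ₀ ∧ ∀ ρ : ℝ, 0 < ρ → ρ < ρ₀ → ∃ c : ℝ, 0 < c ∧ ∀ᶠ N : ℕ in Filter.atTop,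
        ∃ δ : ENNReal, 0 < δ ∧
          ∀ Ψ : Literature.MathematicalPhysics.QuantumManyBody.BoseGas.PeriodicTrialState N
              (Literature.MathematicalPhysics.QuantumManyBody.BoseGas.sideLength ρ N),
            Literature.MathematicalPhysics.QuantumManyBody.BoseGas.periodicEnergy v Ψ ≤
                Literature.MathematicalPhysics.QuantumManyBody.BoseGas.periodicGroundStateEnergy v N
                  (Literature.MathematicalPhysics.QuantumManyBody.BoseGas.sideLength ρ N) + δ →
              ENNReal.ofReal (c * N) ≤
                Literature.MathematicalPhysics.QuantumManyBody.BoseGas.condensateOccupation N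
                  (Literature.MathematicalPhysics.QuantumManyBody.BoseGas.sideLength ρ N) Ψ.ψ :=
  BECIntegerBlockRotorFamilyToPeriodic.familyToPeriodic_proof (familyBEC_of_blockInfraredBound hIR) hFC

/-- **The conjunct from the three open cruxes**: `BlockInfraredBound` (13593), `FillingContinuity` (13594)
and `BoundaryTransferWeak` (0827) imply `BoseEinsteinCondensation` — the route's `closes` with
`BlockModeCounting`, `BlockCondensation`, `FamilyToPeriodic` discharged by their tree proofs. [folklore] -/
theorem bec_of_three_cruxes (hIR : BlockInfraredBound) (hFC : FillingContinuity)
    (hBT : BoundaryTransferWeak) : _root_.BoseEinsteinCondensation :=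
  closes BECIntegerBlockRotorBlockModeCounting.blockModeCounting_proof hIR
    BlockCondensation.rotor_blockCondensation_proof hFC
    BECIntegerBlockRotorFamilyToPeriodic.familyToPeriodic_proof hBT

/-- **The Gaussian-domination entrance**: the KLS transfer (support 13596) and the blocked susceptibility
bound (crux 13592) replace the infrared bound in `bec_of_three_cruxes`. [folklore] -/
theorem bec_of_kls (hKLS : KLSTransfer) (hSB : BlockSusceptibilityBound) (hFC : FillingContinuity)
    (hBT : BoundaryTransferWeak) : _root_.BoseEinsteinCondensation :=
  bec_of_three_cruxes (hKLS hSB) hFC hBT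

end Summit.AtomisticToContinuum.BoseEinsteinCondensation.Theorems.BECIntegerBlockRotorOutright

end
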